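import Summits.AtomisticToContinuum.FouriersLaw.Theorems.BondHeatUncertaintySubdiffusiveBondHeatKernelGibbsD
import Literature.MathematicalPhysics.KineticTheory.LangevinSemigroupProofs
import Mathlib.MeasureTheory.Integral.ExpDecay

/-!
# Kernel-level Gibbs invariance for the pinned chain, part E: the boundary kernel `K_N`

Consequences of the kernel Gibbs invariance (parts A–D) for the boundary kinetic-temperature autocorrelation
`K_N(u) = ∫ (p₀² - T) · P_{u⁺}(p₀² - T) dμ_T` of route `BoundaryEscapeDeficit` (item `BoundaryKernelBasics`,
stmt-AtomisticToContinuum-12239; the same kernel enters crux stmt-AtomisticToContinuum-9120 through the stubs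
`stub_ohmicFloor` / `stub_transientEW` of line `bath-bond-deficit-integral`, whose escape deficit
`E_N = 1 - (γ/T²)∫_{(0,∞)} K_N` is honest only once `K_N ∈ L¹(0,∞)`):

* `pinnedChain_exp_convergence_gibbs` — CEHR (2.5) with the limit IDENTIFIED: `|P_t f(z) - μ_T(f)| ≤ C e^{ϑH(z)} e^{-ct}`
  (Harris uniqueness `pinnedChainSemigroup_ergodic` + invariance of `μ_T`);
* `pinnedChain_kinCorr_exp_decay` — (d) `|K_N(u)| ≤ C e^{-cu}` (`u ≥ 0`), given the static value `μ_T(p₀² - T) = 0`;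
* `pinnedChain_kinCorr_abs_le` — (c) `|K_N(u)| ≤ 2T²`, given `∫ (p₀² - T)² dμ_T ≤ 2T²` (Jensen + `L²`-contraction);
* `pinnedChain_measurable_kinCorr`, `pinnedChain_kinCorr_integrableOn` — (e) `K_N ∈ L¹(0, ∞)`.
The two static inputs are discharged in the assembly file from the Gaussian momentum moments.
-/

noncomputable section

open MeasureTheory ProbabilityTheory Filter Topology Set
open scoped NNReal ENNReal

namespace Summit.AtomisticToContinuum.FouriersLaw.Theorems.SubdiffusiveBondHeat

open Literature.MathematicalPhysics.KineticTheory.HeatConduction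
open Literature.MathematicalPhysics.KineticTheory Literature.Probability.Process OscillatorChain

variable {N : ℕ}

/-! ### Consequences for the boundary kernel `K_N(u) = ⟨p₀² - T, P_u(p₀² - T)⟩_{μ_T}` -/

section Basics

variable {ω₂ lam β γ : ℝ} (hω : 0 < ω₂) (hl : 0 ≤ lam) (hβ : 0 < β) (hγ : 0 < γ) {N : ℕ} (hN : 0 < N)
  {T : ℝ} (hT : 0 < T)
include hω hl hβ hγ hN hT

/-- The Gibbs measure is an invariant probability measure of the transition semigroup of the pinned chain at
equal bath temperatures (all `t ≥ 0`). [cite: CuneoEckmannHairerReyBellet2018, Thm 2.13 and §3.1] -/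
theorem pinnedChainSemigroup_isInvariant_gibbsMeasure :
    (pinnedChainSemigroup hω hl hβ.le hγ.le hN hT.le hT.le).IsInvariant
      ((pinnedChain ω₂ lam β γ).gibbsMeasure N T) :=
  fun t => pinnedChain_gibbsMeasure_bind_transitionKernel hω hl hβ.le hγ.le hN hT t

/-- **Exponential convergence to the Gibbs measure** (CEHR (2.5) at equal temperatures, with the limit
identified): for `0 < ϑ < 1/T` there are `C, c > 0` with `|P_t f(z) - ∫ f dμ_T| ≤ C e^{ϑH(z)} e^{-ct}` for all `z`,
`t ≥ 0` and continuous `f` with `|f| ≤ e^{ϑH}` — Harris uniqueness of the invariant probability measure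
(`pinnedChainSemigroup_ergodic`) identifies the limit measure of (2.5) with `μ_T`, which is invariant by
`pinnedChain_gibbsMeasure_bind_transitionKernel`. [cite: CuneoEckmannHairerReyBellet2018, Thm 2.13 (3)] -/
theorem pinnedChain_exp_convergence_gibbs {ϑ : ℝ} (hϑ0 : 0 < ϑ) (hϑ1 : ϑ < 1 / T) :
    ∃ C c : ℝ, 0 < C ∧ 0 < c ∧ ∀ (z : PhaseSpace N) (t : ℝ≥0) (f : PhaseSpace N → ℝ), Continuous f →
      (∀ y, |f y| ≤ Real.exp (ϑ * (pinnedChain ω₂ lam β γ).hamiltonian N y)) →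
      |∫ y, f y ∂((pinnedChain ω₂ lam β γ).transitionKernel N T T t z) -
          ∫ y, f y ∂((pinnedChain ω₂ lam β γ).gibbsMeasure N T)| ≤
        C * Real.exp (ϑ * (pinnedChain ω₂ lam β γ).hamiltonian N z) * Real.exp (-c * t) := by
  obtain ⟨huniq, μs, hμs, hinv, hrest⟩ := pinnedChainSemigroup_ergodic hω hl hβ hγ hN hT hT
  haveI := pinnedChain_isProbabilityMeasure_gibbsMeasure hω hl hβ.le γ N hT
  have hμ : μs = (pinnedChain ω₂ lam β γ).gibbsMeasure N T :=
    huniq μs _ hμs inferInstance hinv (pinnedChainSemigroup_isInvariant_gibbsMeasure hω hl hβ hγ hN hT)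
  have hmax : ϑ < 1 / max T T := by rwa [max_self]
  obtain ⟨-, C, c, hC, hc, hb⟩ := hrest ϑ hϑ0 hmax
  refine ⟨C, c, hC, hc, fun z t f hf hfb => ?_⟩
  have := hb z t f hf hfb
  rwa [hμ, LangevinChainSemigroup.act_apply, pinnedChainSemigroup_kernel] at this

omit hβ hγ hN hT in
/-- `|p_i² - T| ≤ (2/ϑ + T) e^{ϑH}` for `ϑ > 0`, `T ≥ 0` (`p_i² ≤ 2H`, `ϑH ≤ e^{ϑH}`). [folklore] -/
theorem abs_sq_momentum_sub_le_exp (hβ' : 0 ≤ β) {ϑ : ℝ} (hϑ : 0 < ϑ) (hT' : 0 ≤ T) (z : PhaseSpace N)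
    (i : Fin N) :
    |z.2 i ^ 2 - T| ≤ (2 / ϑ + T) * Real.exp (ϑ * (pinnedChain ω₂ lam β γ).hamiltonian N z) := by
  set Hz := (pinnedChain ω₂ lam β γ).hamiltonian N z
  have hH := pinnedChain_harmonic_le_hamiltonian (ω₂ := ω₂) hl hβ' γ N z
  have h1 : 0 ≤ ∑ j, ω₂ * z.1 j ^ 2 / 2 := Finset.sum_nonneg fun j _ => by positivity
  have h2 : z.2 i ^ 2 / 2 ≤ ∑ j, z.2 j ^ 2 / 2 :=
    Finset.single_le_sum (f := fun j => z.2 j ^ 2 / 2) (fun j _ => by positivity) (Finset.mem_univ _)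
  have hp : z.2 i ^ 2 ≤ 2 * Hz := by linarith
  have hH0 : 0 ≤ Hz := by nlinarith [sq_nonneg (z.2 i)]
  have hexp : ϑ * Hz + 1 ≤ Real.exp (ϑ * Hz) := Real.add_one_le_exp _
  have hE1 : 1 ≤ Real.exp (ϑ * Hz) := Real.one_le_exp (by positivity)
  have hHle : Hz ≤ Real.exp (ϑ * Hz) / ϑ := by
    rw [le_div_iff₀ hϑ]; nlinarith
  have habs : |z.2 i ^ 2 - T| ≤ z.2 i ^ 2 + T := by
    rw [abs_le]; constructor <;> nlinarith [sq_nonneg (z.2 i)]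
  calc |z.2 i ^ 2 - T| ≤ 2 * Hz + T := by linarith
    _ ≤ 2 * (Real.exp (ϑ * Hz) / ϑ) + T * Real.exp (ϑ * Hz) := by nlinarith
    _ = (2 / ϑ + T) * Real.exp (ϑ * Hz) := by ring

omit hβ hγ hN in
/-- `e^{θH}` is integrable for the transition kernels of the pinned chain, `0 < θ < 1/T` (CEHR (3.4)). [folklore] -/
theorem pinnedChain_integrable_exp_mul_hamiltonian_transitionKernel (hβ' : 0 ≤ β) (hγ' : 0 ≤ γ) (hN' : 0 < N)
    {θ : ℝ} (hθ : 0 < θ) (hθ' : θ < 1 / T) (t : ℝ≥0) (z : PhaseSpace N) :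
    Integrable (fun y => Real.exp (θ * (pinnedChain ω₂ lam β γ).hamiltonian N y))
      ((pinnedChain ω₂ lam β γ).transitionKernel N T T t z) := by
  have hmax : θ < 1 / max T T := by rwa [max_self]
  have h34 := lintegral_exp_mul_hamiltonian_pinnedChainSemigroup_le hω hl hβ' hγ' hN' hT.le hT.le hT hT hθ hmax t z
  refine ⟨(Real.continuous_exp.comp (continuous_const.mul
    (pinnedChain_continuous_hamiltonian ω₂ lam β γ N))).aestronglyMeasurable, ?_⟩
  rw [hasFiniteIntegral_iff_ofReal (Eventually.of_forall fun y => (Real.exp_pos _).le)]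
  exact lt_of_le_of_lt h34 ENNReal.ofReal_lt_top

omit hω hl hβ hγ hN hT in
/-- Continuous functions dominated by `C e^{θH}` are integrable for a measure integrating `e^{θH}`. [folklore] -/
theorem integrable_of_abs_le_exp {μ : Measure (PhaseSpace N)} {θ C : ℝ}
    (hint : Integrable (fun y => Real.exp (θ * (pinnedChain ω₂ lam β γ).hamiltonian N y)) μ)
    {g : PhaseSpace N → ℝ} (hg : Continuous g)
    (hle : ∀ y, |g y| ≤ C * Real.exp (θ * (pinnedChain ω₂ lam β γ).hamiltonian N y)) : Integrable g μ :=
  (hint.const_mul C).mono' hg.aestronglyMeasurable (Eventually.of_forall fun y => by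
    rw [Real.norm_eq_abs]; exact hle y)

/-- **Exponential decay of the boundary kernel** (BoundaryKernelBasics (d)): with `θ₀ = p₀² - T`, if `∫ θ₀ dμ_T = 0`
then `|∫ θ₀ (P_u θ₀) dμ_T| ≤ C e^{-cu}` for all `u ≥ 0` (`c > 0`): exponential convergence of `P_uθ₀(z)` to
`μ_T(θ₀) = 0` with weight `e^{ϑH(z)}`, `ϑ = 1/(4T)`, integrated against `|θ₀| e^{ϑH} ≤ const·e^{H/(2T)} ∈ L¹(μ_T)`.
[cite: CuneoEckmannHairerReyBellet2018, Thm 2.13 (3)] -/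
theorem pinnedChain_kinCorr_exp_decay
    (h0 : ∫ z, ((z.2 ⟨0, hN⟩) ^ 2 - T) ∂((pinnedChain ω₂ lam β γ).gibbsMeasure N T) = 0) :
    ∃ C c : ℝ, 0 < c ∧ ∀ u : ℝ, 0 ≤ u →
      |∫ z, ((z.2 ⟨0, hN⟩) ^ 2 - T) *
          (∫ y, ((y.2 ⟨0, hN⟩) ^ 2 - T) ∂((pinnedChain ω₂ lam β γ).transitionKernel N T T u.toNNReal z))
        ∂((pinnedChain ω₂ lam β γ).gibbsMeasure N T)| ≤ C * Real.exp (-c * u) := by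
  set P := pinnedChain ω₂ lam β γ with hP
  set μ := P.gibbsMeasure N T with hμ
  set θ₀ : PhaseSpace N → ℝ := fun z => (z.2 ⟨0, hN⟩) ^ 2 - T with hθ₀
  set ϑ : ℝ := 1 / (4 * T) with hϑ
  have hϑ0 : 0 < ϑ := by positivity
  have hϑ1 : ϑ < 1 / T := by
    rw [hϑ, div_lt_div_iff₀ (by positivity) hT]; nlinarith
  have h2ϑ : 2 * ϑ < 1 / T := by
    rw [hϑ]; rw [show 2 * (1 / (4 * T)) = 1 / (2 * T) by field_simp; ring]
    rw [div_lt_div_iff₀ (by positivity) hT]; nlinarith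
  obtain ⟨C, c, hC, hc, hconv⟩ := pinnedChain_exp_convergence_gibbs hω hl hβ hγ hN hT hϑ0 hϑ1
  set M : ℝ := 2 / ϑ + T with hM
  have hM0 : 0 < M := by positivity
  have hθc : Continuous θ₀ := by fun_prop
  have hθM : ∀ y, |θ₀ y| ≤ M * Real.exp (ϑ * P.hamiltonian N y) := fun y =>
    abs_sq_momentum_sub_le_exp hω hl hβ.le hϑ0 hT.le y ⟨0, hN⟩
  -- the weight `|θ₀| e^{ϑH} ≤ M e^{2ϑH}` is `μ_T`-integrable
  have hwint : Integrable (fun z => |θ₀ z| * Real.exp (ϑ * P.hamiltonian N z)) μ := by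
    have h2 := pinnedChain_integrable_exp_mul_hamiltonian_gibbsMeasure hω hl hβ.le γ N hT h2ϑ
    refine (h2.const_mul M).mono' ((continuous_abs.comp hθc).mul (Real.continuous_exp.comp
      (continuous_const.mul (pinnedChain_continuous_hamiltonian ω₂ lam β γ N)))).aestronglyMeasurable
      (Eventually.of_forall fun z => ?_)
    rw [Real.norm_eq_abs, abs_mul, abs_abs, abs_of_pos (Real.exp_pos _)]
    calc |θ₀ z| * Real.exp (ϑ * P.hamiltonian N z) ≤ (M * Real.exp (ϑ * P.hamiltonian N z)) *
        Real.exp (ϑ * P.hamiltonian N z) := mul_le_mul_of_nonneg_right (hθM z) (Real.exp_pos _).le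
      _ = M * Real.exp (2 * ϑ * P.hamiltonian N z) := by rw [mul_assoc, ← Real.exp_add]; ring_nf
  set W : ℝ := ∫ z, |θ₀ z| * Real.exp (ϑ * P.hamiltonian N z) ∂μ with hW
  refine ⟨M * C * W, c, hc, fun u hu => ?_⟩
  -- pointwise decay of `P_u θ₀`
  have hpt : ∀ z, |∫ y, θ₀ y ∂(P.transitionKernel N T T u.toNNReal z)| ≤
      M * C * Real.exp (ϑ * P.hamiltonian N z) * Real.exp (-c * u) := by
    intro z
    have hf : Continuous fun y => M⁻¹ * θ₀ y := continuous_const.mul hθc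
    have hfb : ∀ y, |M⁻¹ * θ₀ y| ≤ Real.exp (ϑ * P.hamiltonian N y) := fun y => by
      rw [abs_mul, abs_of_pos (inv_pos.2 hM0), inv_mul_le_iff₀ hM0]
      exact hθM y
    have h := hconv z u.toNNReal _ hf hfb
    rw [integral_const_mul, integral_const_mul, h0, mul_zero, sub_zero, abs_mul,
      abs_of_pos (inv_pos.2 hM0), inv_mul_le_iff₀ hM0, Real.coe_toNNReal _ hu] at h
    calc |∫ y, θ₀ y ∂(P.transitionKernel N T T u.toNNReal z)|
        ≤ M * (C * Real.exp (ϑ * P.hamiltonian N z) * Real.exp (-c * u)) := h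
      _ = M * C * Real.exp (ϑ * P.hamiltonian N z) * Real.exp (-c * u) := by ring
  -- integrate
  have hbound : ∀ z, ‖θ₀ z * ∫ y, θ₀ y ∂(P.transitionKernel N T T u.toNNReal z)‖ ≤
      M * C * Real.exp (-c * u) * (|θ₀ z| * Real.exp (ϑ * P.hamiltonian N z)) := fun z => by
    rw [Real.norm_eq_abs, abs_mul]
    calc |θ₀ z| * |∫ y, θ₀ y ∂(P.transitionKernel N T T u.toNNReal z)|
        ≤ |θ₀ z| * (M * C * Real.exp (ϑ * P.hamiltonian N z) * Real.exp (-c * u)) :=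
          mul_le_mul_of_nonneg_left (hpt z) (abs_nonneg _)
      _ = M * C * Real.exp (-c * u) * (|θ₀ z| * Real.exp (ϑ * P.hamiltonian N z)) := by ring
  have := norm_integral_le_of_norm_le (hwint.const_mul (M * C * Real.exp (-c * u))) (Eventually.of_forall hbound)
  rw [integral_const_mul, Real.norm_eq_abs] at this
  calc _ ≤ M * C * Real.exp (-c * u) * W := this
    _ = M * C * W * Real.exp (-c * u) := by ring

end Basics


/-! ### The bound `|K_N(u)| ≤ 2T²`, measurability and integrability of `K_N` -/

section BasicsTwo

variable {ω₂ lam β γ : ℝ} (hω : 0 < ω₂) (hl : 0 ≤ lam) (hβ : 0 < β) (hγ : 0 < γ) {N : ℕ} (hN : 0 < N)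
  {T : ℝ} (hT : 0 < T)
include hω hl hβ hγ hN hT

/-- **`|K_N(u)| ≤ 2T²`** (BoundaryKernelBasics (c), given the static bound `∫ (p₀² - T)² dμ_T ≤ 2T²`): with
`θ₀ = p₀² - T` and `g = P_uθ₀`, `|θ₀ g| ≤ (θ₀² + g²)/2`, Jensen `g² ≤ P_u(θ₀²)` for the Markov kernel, and
invariance `∫ P_u(θ₀²) dμ_T = ∫ θ₀² dμ_T`. [folklore] -/
theorem pinnedChain_kinCorr_abs_le
    (hsq : ∫ z, ((z.2 ⟨0, hN⟩) ^ 2 - T) ^ 2 ∂((pinnedChain ω₂ lam β γ).gibbsMeasure N T) ≤ 2 * T ^ 2) (u : ℝ≥0) :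
    |∫ z, ((z.2 ⟨0, hN⟩) ^ 2 - T) *
        (∫ y, ((y.2 ⟨0, hN⟩) ^ 2 - T) ∂((pinnedChain ω₂ lam β γ).transitionKernel N T T u z))
      ∂((pinnedChain ω₂ lam β γ).gibbsMeasure N T)| ≤ 2 * T ^ 2 := by
  set P := pinnedChain ω₂ lam β γ with hP
  set μ := P.gibbsMeasure N T with hμ
  set κ := P.transitionKernel N T T u with hκ
  haveI : IsProbabilityMeasure μ := pinnedChain_isProbabilityMeasure_gibbsMeasure hω hl hβ.le γ N hT
  haveI : IsMarkovKernel κ := pinnedChain_isMarkovKernel_transitionKernel hω hl hβ.le hγ.le N T T u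
  set θ₀ : PhaseSpace N → ℝ := fun z => (z.2 ⟨0, hN⟩) ^ 2 - T with hθ₀
  have hθc : Continuous θ₀ := by fun_prop
  -- exponential domination and integrability everywhere
  set ϑ : ℝ := 1 / (4 * T) with hϑ
  have hϑ0 : 0 < ϑ := by positivity
  have hϑ1 : ϑ < 1 / T := by rw [hϑ, div_lt_div_iff₀ (by positivity) hT]; nlinarith
  have h2ϑ0 : 0 < 2 * ϑ := by positivity
  have h2ϑ : 2 * ϑ < 1 / T := by
    rw [hϑ, show 2 * (1 / (4 * T)) = 1 / (2 * T) by field_simp; ring, div_lt_div_iff₀ (by positivity) hT]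
    nlinarith
  set M : ℝ := 2 / ϑ + T with hM
  have hθM : ∀ y, |θ₀ y| ≤ M * Real.exp (ϑ * P.hamiltonian N y) := fun y =>
    abs_sq_momentum_sub_le_exp hω hl hβ.le hϑ0 hT.le y ⟨0, hN⟩
  have hθ2M : ∀ y, |θ₀ y ^ 2| ≤ M ^ 2 * Real.exp (2 * ϑ * P.hamiltonian N y) := fun y => by
    rw [abs_pow, show M ^ 2 * Real.exp (2 * ϑ * P.hamiltonian N y) =
      (M * Real.exp (ϑ * P.hamiltonian N y)) ^ 2 by rw [mul_pow, ← Real.exp_nat_mul]; ring_nf]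
    exact pow_le_pow_left₀ (abs_nonneg _) (hθM y) 2
  have hθκ : ∀ z, Integrable θ₀ (κ z) := fun z => integrable_of_abs_le_exp
    (pinnedChain_integrable_exp_mul_hamiltonian_transitionKernel hω hl hT hβ.le hγ.le hN hϑ0 hϑ1 u z) hθc hθM
  have hθ2κ : ∀ z, Integrable (fun y => θ₀ y ^ 2) (κ z) := fun z => integrable_of_abs_le_exp
    (pinnedChain_integrable_exp_mul_hamiltonian_transitionKernel hω hl hT hβ.le hγ.le hN h2ϑ0 h2ϑ u z)
    (hθc.pow 2) hθ2M
  have hθ2μ : Integrable (fun y => θ₀ y ^ 2) μ := integrable_of_abs_le_exp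
    (pinnedChain_integrable_exp_mul_hamiltonian_gibbsMeasure hω hl hβ.le γ N hT h2ϑ) (hθc.pow 2) hθ2M
  -- `g = P_u θ₀` and Jensen
  set g : PhaseSpace N → ℝ := fun z => ∫ y, θ₀ y ∂(κ z) with hg
  have hgm : StronglyMeasurable g := hθc.stronglyMeasurable.integral_kernel (κ := κ)
  have hjensen : ∀ z, g z ^ 2 ≤ ∫ y, θ₀ y ^ 2 ∂(κ z) := by
    intro z
    have hvar : 0 ≤ ∫ y, (θ₀ y - g z) ^ 2 ∂(κ z) := integral_nonneg fun y => sq_nonneg _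
    have hexp : ∫ y, (θ₀ y - g z) ^ 2 ∂(κ z) = (∫ y, θ₀ y ^ 2 ∂(κ z)) - g z ^ 2 := by
      have e : (fun y => (θ₀ y - g z) ^ 2) = fun y => θ₀ y ^ 2 - (2 * g z) * θ₀ y + g z ^ 2 := by
        funext y; ring
      have i1 : Integrable (fun y => θ₀ y ^ 2 - 2 * g z * θ₀ y) (κ z) := (hθ2κ z).sub ((hθκ z).const_mul _)
      rw [e, integral_add i1 (integrable_const _), integral_sub (hθ2κ z) ((hθκ z).const_mul _),
        integral_const_mul, integral_const]
      simp only [probReal_univ, smul_eq_mul, one_mul]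
      rw [show (∫ y, θ₀ y ∂(κ z)) = g z from rfl]
      ring
    linarith
  -- `P_u(θ₀²)` is `μ`-integrable with integral `∫ θ₀² dμ` (invariance)
  have hinv := pinnedChain_gibbsMeasure_bind_transitionKernel hω hl hβ.le hγ.le hN hT u
  have h' : (κ ∘ₖ Kernel.const Unit μ) () = μ := by rw [← Measure.comp_eq_comp_const_apply]; exact hinv
  have hθ2' : Integrable (fun y => θ₀ y ^ 2) ((κ ∘ₖ Kernel.const Unit μ) ()) := by rw [h']; exact hθ2μ
  have hP2int : Integrable (fun z => ∫ y, θ₀ y ^ 2 ∂(κ z)) μ := by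
    have := hθ2'.integral_comp
    rwa [Kernel.const_apply] at this
  have hP2val : ∫ z, (∫ y, θ₀ y ^ 2 ∂(κ z)) ∂μ ≤ 2 * T ^ 2 := by
    rw [pinnedChain_integral_transitionKernel_gibbsMeasure hω hl hβ.le hγ.le hN hT u hθ2μ]
    exact hsq
  -- `g²` is `μ`-integrable
  have hg2int : Integrable (fun z => g z ^ 2) μ :=
    hP2int.mono' (hgm.measurable.pow_const 2).aestronglyMeasurable (Eventually.of_forall fun z => by
      rw [Real.norm_eq_abs, abs_of_nonneg (sq_nonneg _)]; exact hjensen z)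
  have hg2le : ∫ z, g z ^ 2 ∂μ ≤ 2 * T ^ 2 :=
    (integral_mono_of_nonneg (Eventually.of_forall fun z => sq_nonneg _) hP2int
      (Eventually.of_forall hjensen)).trans hP2val
  -- AM–GM and integration
  have hbound : ∀ z, ‖θ₀ z * g z‖ ≤ (θ₀ z ^ 2 + g z ^ 2) / 2 := fun z => by
    rw [Real.norm_eq_abs, abs_mul]
    nlinarith [sq_nonneg (|θ₀ z| - |g z|), sq_abs (θ₀ z), sq_abs (g z), abs_nonneg (θ₀ z), abs_nonneg (g z)]
  have hbint : Integrable (fun z => (θ₀ z ^ 2 + g z ^ 2) / 2) μ := (hθ2μ.add hg2int).div_const 2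
  have := norm_integral_le_of_norm_le hbint (Eventually.of_forall hbound)
  rw [Real.norm_eq_abs, integral_div, integral_add hθ2μ hg2int] at this
  linarith

/-- `K_N` is a measurable function of time (joint measurability of the transition kernels in `(t, z)`). [folklore] -/
theorem pinnedChain_measurable_kinCorr :
    Measurable fun u : ℝ => ∫ z, ((z.2 ⟨0, hN⟩) ^ 2 - T) *
        (∫ y, ((y.2 ⟨0, hN⟩) ^ 2 - T) ∂((pinnedChain ω₂ lam β γ).transitionKernel N T T u.toNNReal z))
      ∂((pinnedChain ω₂ lam β γ).gibbsMeasure N T) := by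
  set P := pinnedChain ω₂ lam β γ with hP
  set μ := P.gibbsMeasure N T with hμ
  haveI : IsProbabilityMeasure μ := pinnedChain_isProbabilityMeasure_gibbsMeasure hω hl hβ.le γ N hT
  set θ₀ : PhaseSpace N → ℝ := fun z => (z.2 ⟨0, hN⟩) ^ 2 - T with hθ₀
  have hθc : Continuous θ₀ := by fun_prop
  -- the kernels as ONE kernel on `ℝ≥0 × Ω`
  let κ₂ : Kernel (ℝ≥0 × PhaseSpace N) (PhaseSpace N) :=
    { toFun := fun p => P.transitionKernel N T T p.1 p.2
      measurable' := pinnedChain_measurable_transitionKernel hω hl hβ.le hγ.le N T T }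
  have hG : StronglyMeasurable fun p : ℝ≥0 × PhaseSpace N => ∫ y, θ₀ y ∂(κ₂ p) :=
    hθc.stronglyMeasurable.integral_kernel (κ := κ₂)
  have hF : StronglyMeasurable fun q : ℝ × PhaseSpace N =>
      θ₀ q.2 * ∫ y, θ₀ y ∂(P.transitionKernel N T T q.1.toNNReal q.2) := by
    have h1 : StronglyMeasurable fun q : ℝ × PhaseSpace N => θ₀ q.2 :=
      (hθc.comp continuous_snd).stronglyMeasurable
    have h2 : StronglyMeasurable fun q : ℝ × PhaseSpace N => ∫ y, θ₀ y ∂(κ₂ (q.1.toNNReal, q.2)) :=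
      hG.comp_measurable ((measurable_real_toNNReal.comp measurable_fst).prodMk measurable_snd)
    exact h1.mul h2
  exact (hF.integral_prod_right' (ν := μ)).measurable

/-- **`K_N ∈ L¹(0, ∞)`** (BoundaryKernelBasics (e), given `∫ θ₀ dμ_T = 0`): measurability and the exponential decay
`pinnedChain_kinCorr_exp_decay`. [folklore] -/
theorem pinnedChain_kinCorr_integrableOn
    (h0 : ∫ z, ((z.2 ⟨0, hN⟩) ^ 2 - T) ∂((pinnedChain ω₂ lam β γ).gibbsMeasure N T) = 0) :
    IntegrableOn (fun u : ℝ => ∫ z, ((z.2 ⟨0, hN⟩) ^ 2 - T) *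
        (∫ y, ((y.2 ⟨0, hN⟩) ^ 2 - T) ∂((pinnedChain ω₂ lam β γ).transitionKernel N T T u.toNNReal z))
      ∂((pinnedChain ω₂ lam β γ).gibbsMeasure N T)) (Ioi 0) := by
  obtain ⟨C, c, hc, hb⟩ := pinnedChain_kinCorr_exp_decay hω hl hβ hγ hN hT h0
  refine Integrable.mono' ((exp_neg_integrableOn_Ioi 0 hc).const_mul C)
    (pinnedChain_measurable_kinCorr hω hl hβ hγ hN hT).aestronglyMeasurable ?_
  refine (ae_restrict_iff' measurableSet_Ioi).2 (Eventually.of_forall fun u hu => ?_)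
  rw [Real.norm_eq_abs]
  exact hb u (le_of_lt hu)

end BasicsTwo

end Summit.AtomisticToContinuum.FouriersLaw.Theorems.SubdiffusiveBondHeat

end
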